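import Literature.NumberTheory.EllipticCurves.CuspFormLFunctionProofs
import Literature.MeasureTheory.Group.SL2CoordSetIntegral
import Mathlib.Analysis.Fourier.AddCircle
import Mathlib.Analysis.SpecialFunctions.Gamma.Basic
import HarnessLib

/-!
# Parseval on horizontal lines and the strip integral `∫₀^∞∫₀¹ |f|² yᵃ dx dy/y²` of a cusp form

Topic `Literature/NumberTheory/EllipticCurves`; theorems only (no definition, no named fact). Third
brick (after `NewformPeterssonSizeProofs.lean`, `Gamma0RankinSelbergUnfolding.lean`) of the printed
proof behind the named fact `murty_petersson_newform_lower_bound` (Murty 1999, §2: Rankin–Selberg,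
then Hoffstein–Lockhart): the right-hand side of the unfolding identity. For a cusp form `f` of
weight `k` on a level `Γ` with `1 ∈ Γ.strictPeriods` (e.g. `Γ₀(N)`, `Γ₁(N)`), `aₙ = cuspCoeff f n`:

1. `hasSum_horizontal`: `f(x + it) = Σₙ aₙ e^{-2πnt} e^{2πinx}` (Mathlib `hasSum_qExpansion`);
   `summable_norm_cuspCoeff_mul_exp`: `Σ ‖aₙ‖ e^{-2πnt} < ∞` (`hasSum_qExpansion_of_norm_lt`).
2. `fourierCoeffOn_horizontal_int`: **all** Fourier coefficients of `x ↦ f(x + it)` on `[0, 1]`: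
   `aₙ e^{-2πnt}` at `i = n ≥ 0` and `0` at `i < 0` (`fourierCoeffOn_horizontal_of_neg`), by
   dominated convergence (`intervalIntegral.hasSum_integral_of_dominated_convergence`) and
   `∫₀¹ e^{2πimx} dx = [m = 0]` (`intervalIntegral_exp_two_pi_mul_I_int`). (The tree's
   `fourierCoeffOn_horizontal`, `CuspFormLFunctionProofs.lean`, is the case `i ≥ 0`.)
3. `hasSum_sq_cuspCoeff_mul_exp`: **Parseval on a horizontal line**,
   `Σₙ ‖aₙ‖² e^{-4πnt} = ∫₀¹ ‖f(x + it)‖² dx` (Mathlib `hasSum_sq_fourierCoeffOn` over `ℤ`, the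
   negative half vanishing) — Rankin 1939, (2.?)/Diamond–Shurman Ex. 5.9; the tree previously had
   only Bessel's inequality `≤` (`sum_sq_cuspCoeff_mul_exp_le`).
4. `measurable_ofComplex` (Mathlib's `UpperHalfPlane.ofComplex` is Borel measurable),
   `lintegral_strip_eq_lintegral_Ioi_Ico` (the strip `{0 ≤ Re < 1} ⊆ ℍ` in coordinates:
   `∫⁻ = ∫⁻_{y>0} ∫⁻_{0≤x<1} · y⁻² dx dy`, from the tree's `setLIntegral_coe_preimage`),
   `lintegral_Ioi_rpow_mul_exp_neg_mul` (`∫₀^∞ y^{a-1} e^{-ry} dy = Γ(a) r^{-a}` in `ℝ≥0∞`,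
   Mathlib `Real.integral_rpow_mul_exp_neg_mul_Ioi`).
5. `lintegral_strip_normSq_mul_rpow`: **the strip integral is a Dirichlet series** — for real
   `a > 1`, in `ℝ≥0∞` (no convergence hypothesis),
   `∫⁻_{0 ≤ Re ρ < 1} |f(ρ)|² (Im ρ)ᵃ dμ(ρ) = Σₙ ‖aₙ‖² Γ(a − 1) (4πn)^{1−a}`
   (`dμ = dx dy/y²`; Tonelli twice). With `a = k + s` this is the classical
   `∫₀^∞∫₀¹ |f|² y^{k+s} dx dy/y² = (4π)^{1-k-s} Γ(s + k − 1) Σ |aₙ|² n^{1-k-s}` (Rankin 1939;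
   Iwaniec, *Topics in classical automorphic forms*, §13.?; Diamond–Shurman §5.10 for the Mellin
   pattern), the right-hand side of the Rankin–Selberg unfolding
   (`Gamma0RankinSelbergUnfolding.lintegral_domain_mul_eisenstein_eq`).

## References

* R. A. Rankin, Proc. Cambridge Philos. Soc. 35 (1939), 351–372 (the method).
* [DiamondShurman2005] F. Diamond, J. Shurman, *A First Course in Modular Forms*, GTM 228, §5.9
  (Fourier coefficients as integrals), Ex. 5.9 (Parseval), §5.10 (Mellin transforms).
* [Iwaniec2002] H. Iwaniec, *Spectral Methods of Automorphic Forms*, §3.2 (unfolding).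
* [Murty1999CongruencePrimes] M. R. Murty, *Bounds for congruence primes* (1999), §2.
-/

noncomputable section

open scoped MatrixGroups ModularForm Real ENNReal NNReal
open UpperHalfPlane hiding I
open MeasureTheory Set Filter Complex intervalIntegral

namespace Literature.NumberTheory.EllipticCurves.ModularForms


/-! ### Parseval on horizontal lines -/

section Parseval

variable {Γ : Subgroup (GL (Fin 2) ℝ)} {k : ℤ}

/-- **The `q`-expansion on a horizontal line**: for `t > 0` and `x ∈ ℝ`,
`f(x + it) = Σₙ aₙ e^{-2πnt} e^{2πinx}` (`q = e^{2πi(x+it)}`; Mathlib `UpperHalfPlane.hasSum_qExpansion`;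
Diamond–Shurman §1.1). [folklore] -/
theorem hasSum_horizontal (hΓ : (1 : ℝ) ∈ Γ.strictPeriods) (f : CuspForm Γ k) {t : ℝ} (ht : 0 < t)
    (x : ℝ) :
    HasSum (fun n : ℕ ↦ cuspCoeff f n * (Real.exp (-(2 * π * n * t)) : ℝ) *
        Complex.exp (2 * π * Complex.I * n * x))
      (f ⟨x + t * Complex.I, by simp [ht]⟩) := by
  haveI : Fact (IsCusp OnePoint.infty Γ) := ⟨Γ.isCusp_of_mem_strictPeriods one_pos hΓ⟩
  have h := UpperHalfPlane.hasSum_qExpansion one_pos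
    (SlashInvariantFormClass.periodic_comp_ofComplex f hΓ) (ModularFormClass.holo f)
    (ModularFormClass.bdd_at_infty f) ⟨x + t * Complex.I, by simp [ht]⟩
  convert h using 2 with n
  rw [cuspCoeff, smul_eq_mul, mul_assoc]
  congr 1
  rw [Function.Periodic.qParam, ← Complex.exp_nat_mul, Complex.ofReal_exp, ← Complex.exp_add,
    UpperHalfPlane.coe_mk]
  congr 1
  push_cast
  rw [div_one, show (n : ℂ) * (2 * π * Complex.I * (x + t * Complex.I)) =
    2 * π * Complex.I * n * x + (Complex.I * Complex.I) * (2 * π * n * t) by ring, I_mul_I]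
  ring

/-- `Σₙ ‖aₙ‖ e^{-2πnt} < ∞` for `t > 0` (absolute convergence of the `q`-expansion inside the unit
disc, Mathlib `hasSum_qExpansion_of_norm_lt`). [folklore] -/
theorem summable_norm_cuspCoeff_mul_exp (hΓ : (1 : ℝ) ∈ Γ.strictPeriods) (f : CuspForm Γ k)
    {t : ℝ} (ht : 0 < t) :
    Summable fun n : ℕ ↦ ‖cuspCoeff f n‖ * Real.exp (-(2 * π * n * t)) := by
  haveI : Fact (IsCusp OnePoint.infty Γ) := ⟨Γ.isCusp_of_mem_strictPeriods one_pos hΓ⟩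
  have hq : ‖(Real.exp (-(2 * π * t)) : ℂ)‖ < 1 := by
    rw [Complex.norm_real, Real.norm_of_nonneg (Real.exp_pos _).le, Real.exp_lt_one_iff]
    have := Real.pi_pos
    nlinarith
  have h := (UpperHalfPlane.hasSum_qExpansion_of_norm_lt one_pos
    (SlashInvariantFormClass.periodic_comp_ofComplex f hΓ) (ModularFormClass.holo f)
    (ModularFormClass.bdd_at_infty f) hq).summable.norm
  refine h.congr fun n ↦ ?_
  rw [cuspCoeff, smul_eq_mul, norm_mul, norm_pow, Complex.norm_real,
    Real.norm_of_nonneg (Real.exp_pos _).le, ← Real.exp_nat_mul]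
  congr 2
  ring

/-- Orthogonality of characters on `[0, 1]`: `∫₀¹ e^{2πimx} dx = 1` if `m = 0` and `0` otherwise
(`m ∈ ℤ`). [folklore] -/
theorem intervalIntegral_exp_two_pi_mul_I_int (m : ℤ) :
    ∫ x in (0 : ℝ)..1, Complex.exp (2 * π * Complex.I * m * x) = if m = 0 then 1 else 0 := by
  split_ifs with hm
  · simp [hm]
  · have hc : (2 * π * Complex.I * m : ℂ) ≠ 0 := by
      simp [Real.pi_ne_zero, Complex.I_ne_zero, hm]
    rw [integral_exp_mul_complex hc]
    simp only [Complex.ofReal_one, mul_one, Complex.ofReal_zero, mul_zero, Complex.exp_zero]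
    rw [show (2 * π * Complex.I * m : ℂ) = m * (2 * π * Complex.I) by ring,
      Complex.exp_int_mul_two_pi_mul_I, sub_self, zero_div]

/-- **All Fourier coefficients of `x ↦ f(x + it)` on `[0, 1]`** (`t > 0`): the `i`-th coefficient
is `aₙ e^{-2πnt}` if `i = n ≥ 0` and `0` if `i < 0` — written as `Σₙ [n = i] aₙ e^{-2πnt}`. Termwise
integration of the `q`-expansion (dominated convergence with the summable majorant
`‖aₙ‖ e^{-2πnt}`) and orthogonality. (Diamond–Shurman §1.1 / proof of Prop. 5.9.1.) [folklore] -/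
theorem fourierCoeffOn_horizontal_int (hΓ : (1 : ℝ) ∈ Γ.strictPeriods) (f : CuspForm Γ k)
    {t : ℝ} (ht : 0 < t) (i : ℤ) :
    fourierCoeffOn zero_lt_one (fun x : ℝ ↦ f ⟨x + t * Complex.I, by simp [ht]⟩) i =
      ∑' n : ℕ, if (n : ℤ) = i then cuspCoeff f n * (Real.exp (-(2 * π * n * t)) : ℝ) else 0 := by
  rw [fourierCoeffOn_eq_integral]
  simp only [sub_zero, div_one, one_smul]
  -- the terms
  set F : ℕ → ℝ → ℂ := fun n x ↦ fourier (-i) (x : AddCircle ((1 : ℝ) - 0)) •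
    (cuspCoeff f n * (Real.exp (-(2 * π * n * t)) : ℝ) * Complex.exp (2 * π * Complex.I * n * x))
    with hF
  have hsum := summable_norm_cuspCoeff_mul_exp hΓ f ht
  have hlim : ∀ x : ℝ, HasSum (fun n ↦ F n x)
      (fourier (-i) (x : AddCircle ((1 : ℝ) - 0)) • f ⟨x + t * Complex.I, by simp [ht]⟩) := fun x ↦
    (hasSum_horizontal hΓ f ht x).const_smul _
  have hbound : ∀ n x, ‖F n x‖ ≤ ‖cuspCoeff f n‖ * Real.exp (-(2 * π * n * t)) := by
    intro n x
    rw [hF]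
    dsimp only
    rw [norm_smul, fourier_apply, Circle.norm_coe, one_mul, norm_mul, norm_mul, Complex.norm_real,
      Real.norm_of_nonneg (Real.exp_pos _).le, Complex.norm_exp]
    have : (2 * π * Complex.I * n * x : ℂ).re = 0 := by
      simp [Complex.mul_re, Complex.I_re, Complex.I_im]
    rw [this, Real.exp_zero, mul_one]
  have hcont : ∀ n, Continuous (F n) := by
    intro n
    rw [hF]
    refine ((fourier (-i)).continuous.comp (AddCircle.continuous_mk' ((1 : ℝ) - 0))).smul
      (continuous_const.mul ?_)
    exact Complex.continuous_exp.comp (continuous_const.mul Complex.continuous_ofReal)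
  have hDCT := intervalIntegral.hasSum_integral_of_dominated_convergence
    (μ := volume) (a := 0) (b := 1) (fun n (_ : ℝ) ↦ ‖cuspCoeff f n‖ * Real.exp (-(2 * π * n * t)))
    (F := F) (fun n ↦ (hcont n).aestronglyMeasurable)
    (fun n ↦ ae_of_all _ fun x _ ↦ hbound n x)
    (ae_of_all _ fun x _ ↦ hsum) intervalIntegrable_const
    (ae_of_all _ fun x _ ↦ hlim x)
  -- evaluate `∫₀¹ F n`
  have h2 : ∀ n : ℕ, ∫ x in (0 : ℝ)..1, F n x =
      if (n : ℤ) = i then cuspCoeff f n * (Real.exp (-(2 * π * n * t)) : ℝ) else 0 := by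
    intro n
    have e : ∀ x : ℝ, F n x = (cuspCoeff f n * (Real.exp (-(2 * π * n * t)) : ℝ)) *
        Complex.exp (2 * π * Complex.I * ((n : ℤ) - i : ℤ) * x) := by
      intro x
      rw [hF]
      dsimp only
      rw [fourier_coe_apply, smul_eq_mul, show (((1 : ℝ) - 0 : ℝ) : ℂ) = 1 by push_cast; ring,
        div_one]
      rw [show (2 * π * Complex.I * ((((n : ℤ) - i : ℤ)) : ℂ) * x : ℂ) =
        2 * π * Complex.I * ((-i : ℤ) : ℂ) * x + 2 * π * Complex.I * n * x by push_cast; ring,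
        Complex.exp_add]
      ring
    simp_rw [e]
    rw [intervalIntegral.integral_const_mul, intervalIntegral_exp_two_pi_mul_I_int]
    by_cases hni : (n : ℤ) = i
    · rw [if_pos (sub_eq_zero.mpr hni), if_pos hni, mul_one]
    · rw [if_neg (fun h ↦ hni (sub_eq_zero.mp h)), if_neg hni, mul_zero]
  have h3 : HasSum (fun n : ℕ ↦ if (n : ℤ) = i then
      cuspCoeff f n * (Real.exp (-(2 * π * n * t)) : ℝ) else 0)
      (∫ x in (0 : ℝ)..1, fourier (-i) (x : AddCircle ((1 : ℝ) - 0)) •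
        f ⟨x + t * Complex.I, by simp [ht]⟩) := by
    have := hDCT
    simp_rw [h2] at this
    exact this
  exact h3.tsum_eq.symm

/-- The negative Fourier coefficients of `x ↦ f(x + it)` vanish (a cusp form has a `q`-expansion in
nonnegative powers of `q`). [folklore] -/
theorem fourierCoeffOn_horizontal_of_neg (hΓ : (1 : ℝ) ∈ Γ.strictPeriods) (f : CuspForm Γ k)
    {t : ℝ} (ht : 0 < t) {i : ℤ} (hi : i < 0) :
    fourierCoeffOn zero_lt_one (fun x : ℝ ↦ f ⟨x + t * Complex.I, by simp [ht]⟩) i = 0 := by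
  rw [fourierCoeffOn_horizontal_int hΓ f ht i]
  refine (tsum_congr fun n ↦ ?_).trans tsum_zero
  rw [if_neg]
  omega

/-- **Parseval on a horizontal line**: for a cusp form `f` on a level with strict period `1` and
`t > 0`, `Σₙ ‖aₙ‖² e^{-4πnt} = ∫₀¹ ‖f(x + it)‖² dx` (Mathlib's Parseval identity
`hasSum_sq_fourierCoeffOn` over `i ∈ ℤ`, the coefficients being `aₙe^{-2πnt}` for `i = n ≥ 0` and
`0` for `i < 0`). Rankin 1939; Diamond–Shurman Ex. 5.9.? (the tree's `sum_sq_cuspCoeff_mul_exp_le`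
is the inequality `≤`). [cite: DiamondShurman2005, §5.9 (proof of Prop. 5.9.1: Parseval on the line Im τ = t)] -/
theorem hasSum_sq_cuspCoeff_mul_exp (hΓ : (1 : ℝ) ∈ Γ.strictPeriods) (f : CuspForm Γ k) {t : ℝ}
    (ht : 0 < t) :
    HasSum (fun n : ℕ ↦ ‖cuspCoeff f n‖ ^ 2 * Real.exp (-(4 * π * n * t)))
      (∫ x in (0 : ℝ)..1, ‖f ⟨x + t * Complex.I, by simp [ht]⟩‖ ^ 2) := by
  set F : ℝ → ℂ := fun x : ℝ ↦ f ⟨x + t * Complex.I, by simp [ht]⟩ with hF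
  have hFc : Continuous F := by
    apply (ModularFormClass.continuous f).comp
    fun_prop (disch := simp [ht])
  obtain ⟨C, hC⟩ := isCompact_Icc.exists_bound_of_continuousOn (hFc.continuousOn (s := Icc (0 : ℝ) 1))
  have hL2 : MemLp F 2 (volume.restrict (Ioc 0 1)) :=
    MemLp.of_bound hFc.aestronglyMeasurable C
      ((ae_restrict_iff' measurableSet_Ioc).mpr (ae_of_all _ fun x hx ↦ hC x (Ioc_subset_Icc_self hx)))
  have hP := hasSum_sq_fourierCoeffOn zero_lt_one hL2
  simp only [sub_zero, inv_one, one_smul] at hP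
  set g : ℤ → ℝ := fun i ↦ ‖fourierCoeffOn zero_lt_one F i‖ ^ 2 with hg
  have hneg : ∀ n : ℕ, g (-(n + 1 : ℕ) : ℤ) = 0 := fun n ↦ by
    rw [hg]
    dsimp only
    rw [hF, fourierCoeffOn_horizontal_of_neg hΓ f ht (by omega), norm_zero, zero_pow two_ne_zero]
  have hnat : ∀ n : ℕ, g (n : ℤ) = ‖cuspCoeff f n‖ ^ 2 * Real.exp (-(4 * π * n * t)) := fun n ↦ by
    rw [hg]
    dsimp only
    rw [hF, fourierCoeffOn_horizontal hΓ f ht n, norm_mul, mul_pow, Complex.norm_real,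
      Real.norm_of_nonneg (Real.exp_pos _).le, ← Real.exp_nat_mul]
    congr 2
    push_cast
    ring
  have hsum : Summable fun n : ℕ ↦ g (n : ℤ) := hP.summable.comp_injective Nat.cast_injective
  have h1 : HasSum (fun n : ℕ ↦ g (n : ℤ)) (∑' n : ℕ, g (n : ℤ)) := hsum.hasSum
  have h2 : HasSum (fun n : ℕ ↦ g (-(n + 1 : ℕ) : ℤ)) 0 := by
    simp_rw [hneg]
    exact hasSum_zero
  have h3 : HasSum g ((∑' n : ℕ, g (n : ℤ)) + 0) := HasSum.of_nat_of_neg_add_one h1 (by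
    convert h2 using 2 with n
    push_cast
    ring_nf)
  have h4 : (∑' n : ℕ, g (n : ℤ)) = ∫ x in (0 : ℝ)..1, ‖F x‖ ^ 2 := by
    rw [← add_zero (∑' n : ℕ, g (n : ℤ))]
    exact h3.unique hP
  rw [← h4]
  simpa only [hnat] using h1

end Parseval

/-! ### The strip in coordinates; the `Γ`-integral -/

section Strip

open Literature.MeasureTheory.Group

/-- Mathlib's retraction `UpperHalfPlane.ofComplex : ℂ → ℍ` (inverse of the inclusion on
`{Im > 0}`, an arbitrary constant elsewhere) is Borel measurable: it is continuous on the measurable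
set `{Im > 0}` and constant on its complement. [folklore] -/
theorem measurable_ofComplex : Measurable (UpperHalfPlane.ofComplex : ℂ → ℍ) := by
  classical
  set U : Set ℂ := {z : ℂ | 0 < z.im} with hU
  have hmeasU : MeasurableSet U := UpperHalfPlane.isOpen_upperHalfPlaneSet.measurableSet
  have hsrc : UpperHalfPlane.ofComplex.source = U := by simp [UpperHalfPlane.ofComplex, hU]
  have hc : ContinuousOn (UpperHalfPlane.ofComplex : ℂ → ℍ) U := by
    rw [← hsrc]; exact UpperHalfPlane.ofComplex.continuousOn
  have heq : (UpperHalfPlane.ofComplex : ℂ → ℍ) =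
      U.piecewise UpperHalfPlane.ofComplex (fun _ ↦ UpperHalfPlane.ofComplex 0) := by
    funext w
    by_cases hw : w ∈ U
    · rw [piecewise_eq_of_mem _ _ _ hw]
    · rw [piecewise_eq_of_notMem _ _ _ hw]
      have hw' : w.im ≤ 0 := not_lt.mp hw
      exact ofComplex_apply_eq_of_im_nonpos hw' (by simp)
  rw [heq]
  exact hc.measurable_piecewise continuousOn_const hmeasU

/-- **The strip `{0 ≤ Re < 1} ⊆ ℍ` in coordinates**: for a measurable `F : ℂ → ℝ≥0∞`,
`∫⁻_{0 ≤ Re ρ < 1} F(ρ) dμ(ρ) = ∫⁻_{y > 0} ∫⁻_{0 ≤ x < 1} F(x + iy) y⁻² dx dy` (`dμ = dx dy/y²`,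
Mathlib `UpperHalfPlane.volume`; the tree's `setLIntegral_coe_preimage`, `ℂ ≃ᵐ ℝ × ℝ`, Tonelli). [folklore] -/
theorem lintegral_strip_eq_lintegral_Ioi_Ico (F : ℂ → ℝ≥0∞) (hF : Measurable F) :
    ∫⁻ ρ in {ρ : ℍ | 0 ≤ ρ.re ∧ ρ.re < 1}, F ρ =
      ∫⁻ y in Ioi (0 : ℝ), ∫⁻ x in Ico (0 : ℝ) 1, F (⟨x, y⟩ : ℂ) * ENNReal.ofReal (1 / y ^ 2) := by
  set A : Set ℂ := {w : ℂ | (0 ≤ w.re ∧ w.re < 1) ∧ 0 < w.im} with hA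
  have hAm : MeasurableSet A :=
    ((measurableSet_le measurable_const Complex.measurable_re).inter
      (measurableSet_lt Complex.measurable_re measurable_const)).inter
      (measurableSet_lt measurable_const Complex.measurable_im)
  have hpre : {ρ : ℍ | 0 ≤ ρ.re ∧ ρ.re < 1} = ((↑) : ℍ → ℂ) ⁻¹' A := by
    ext ρ
    simp only [mem_setOf_eq, mem_preimage, hA, UpperHalfPlane.coe_re, UpperHalfPlane.coe_im,
      ρ.im_pos, and_true]
  rw [hpre, setLIntegral_coe_preimage hAm (fun w hw ↦ hw.2) F hF]
  have hmp := Complex.volume_preserving_equiv_real_prod.symm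
  rw [← hmp.setLIntegral_comp_preimage_emb Complex.measurableEquivRealProd.symm.measurableEmbedding]
  have hpre2 : Complex.measurableEquivRealProd.symm ⁻¹' A = Ico (0 : ℝ) 1 ×ˢ Ioi (0 : ℝ) := by
    ext p
    simp only [hA, mem_preimage, mem_setOf_eq, Complex.measurableEquivRealProd_symm_apply, mem_prod,
      mem_Ico, mem_Ioi]
  rw [hpre2]
  have hGm : Measurable fun p : ℝ × ℝ ↦
      F (Complex.measurableEquivRealProd.symm p) * ENNReal.ofReal (1 / (Complex.measurableEquivRealProd.symm p).im ^ 2) :=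
    (hF.comp Complex.measurableEquivRealProd.symm.measurable).mul
      ((measurable_const.div (Complex.measurable_im.comp
        Complex.measurableEquivRealProd.symm.measurable |>.pow_const 2)).ennreal_ofReal)
  rw [Measure.volume_eq_prod, ← Measure.prod_restrict, lintegral_prod_symm _ hGm.aemeasurable]
  rfl

/-- `∫₀^∞ y^{a-1} e^{-ry} dy = Γ(a) r^{-a}` for `a, r > 0`, as a lower Lebesgue integral (Mathlib
`Real.integral_rpow_mul_exp_neg_mul_Ioi`). [folklore] -/
theorem lintegral_Ioi_rpow_mul_exp_neg_mul {a r : ℝ} (ha : 0 < a) (hr : 0 < r) :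
    ∫⁻ y in Ioi (0 : ℝ), ENNReal.ofReal (y ^ (a - 1) * Real.exp (-(r * y))) =
      ENNReal.ofReal ((1 / r) ^ a * Real.Gamma a) := by
  rw [← Real.integral_rpow_mul_exp_neg_mul_Ioi ha hr, ofReal_integral_eq_lintegral_ofReal]
  · have h := integrableOn_rpow_mul_exp_neg_mul_rpow (s := a - 1) (p := 1) (b := r)
      (by linarith) le_rfl hr
    refine h.congr_fun (fun y hy ↦ ?_) measurableSet_Ioi
    simp only [Real.rpow_one, neg_mul]
  · filter_upwards [ae_restrict_mem measurableSet_Ioi] with y hy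
    exact mul_nonneg (Real.rpow_nonneg hy.le _) (Real.exp_pos _).le

end Strip

/-! ### The strip integral of `|f|² yᵃ` -/

section StripCuspForm

variable {Γ : Subgroup (GL (Fin 2) ℝ)} {k : ℤ}

/-- Parseval on a horizontal line in `ℝ≥0∞`: `∫⁻_{[0,1)} ‖f(x + iy)‖² dx = Σₙ ‖aₙ‖² e^{-4πny}`
(`y > 0`). [folklore] -/
theorem lintegral_Ico_normSq_line_eq_tsum (hΓ : (1 : ℝ) ∈ Γ.strictPeriods) (f : CuspForm Γ k)
    {y : ℝ} (hy : 0 < y) :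
    ∫⁻ x in Ico (0 : ℝ) 1, ENNReal.ofReal (‖f ⟨x + y * Complex.I, by simp [hy]⟩‖ ^ 2) =
      ∑' n : ℕ, ENNReal.ofReal (‖cuspCoeff f n‖ ^ 2 * Real.exp (-(4 * π * n * y))) := by
  have hFc : Continuous fun x : ℝ ↦ ‖f ⟨x + y * Complex.I, by simp [hy]⟩‖ ^ 2 := by
    refine (Continuous.norm ?_).pow 2
    apply (ModularFormClass.continuous f).comp
    fun_prop (disch := simp [hy])
  have hI : IntegrableOn (fun x : ℝ ↦ ‖f ⟨x + y * Complex.I, by simp [hy]⟩‖ ^ 2) (Ico (0 : ℝ) 1) :=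
    hFc.integrableOn_Icc.mono_set Ico_subset_Icc_self
  rw [← ofReal_integral_eq_lintegral_ofReal hI (ae_of_all _ fun x ↦ sq_nonneg _),
    integral_Ico_eq_integral_Ioc, ← intervalIntegral.integral_of_le zero_le_one,
    ← (hasSum_sq_cuspCoeff_mul_exp hΓ f hy).tsum_eq,
    ENNReal.ofReal_tsum_of_nonneg (fun n ↦ by positivity) (hasSum_sq_cuspCoeff_mul_exp hΓ f hy).summable]

/-- **The strip integral of `|f|² yᵃ` is a Dirichlet series** (Rankin 1939; the right-hand side of
the Rankin–Selberg unfolding): for a cusp form `f` on a level with strict period `1` and real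
`a > 1`, in `ℝ≥0∞`,
`∫⁻_{0 ≤ Re ρ < 1} ‖f ρ‖² (Im ρ)ᵃ dμ(ρ) = Σₙ ‖aₙ‖² · (4πn)^{1-a} Γ(a − 1)`
— coordinates (`dμ = dx dy/y²`), Parseval in `x` (`lintegral_Ico_normSq_line_eq_tsum`), Tonelli, and
`∫₀^∞ y^{a-2} e^{-4πny} dy = Γ(a-1)(4πn)^{1-a}` (`lintegral_Ioi_rpow_mul_exp_neg_mul`; the term
`n = 0` vanishes as `a₀ = 0`). With `a = k + s`: `(4π)^{1-k-s} Γ(s+k-1) Σ |aₙ|² n^{1-k-s}`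
(Diamond–Shurman §5.10 pattern; Iwaniec §3.2). [cite: Iwaniec2002, §3.2 (3.13) (right-hand side of the unfolding), PDF p. 43] -/
theorem lintegral_strip_normSq_mul_rpow (hΓ : (1 : ℝ) ∈ Γ.strictPeriods) (f : CuspForm Γ k) {a : ℝ}
    (ha : 1 < a) :
    ∫⁻ ρ in {ρ : ℍ | 0 ≤ ρ.re ∧ ρ.re < 1}, ENNReal.ofReal (‖f ρ‖ ^ 2 * ρ.im ^ a) =
      ∑' n : ℕ, ENNReal.ofReal (‖cuspCoeff f n‖ ^ 2 *
        ((1 / (4 * π * n)) ^ (a - 1) * Real.Gamma (a - 1))) := by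
  set F : ℂ → ℝ≥0∞ := fun w ↦ ENNReal.ofReal (‖f (ofComplex w)‖ ^ 2 * w.im ^ a) with hFdef
  have hF : Measurable F :=
    ((((ModularFormClass.continuous f).measurable.comp measurable_ofComplex).norm.pow_const 2).mul
      (Complex.measurable_im.pow_const a)).ennreal_ofReal
  have e0 : ∫⁻ ρ in {ρ : ℍ | 0 ≤ ρ.re ∧ ρ.re < 1}, ENNReal.ofReal (‖f ρ‖ ^ 2 * ρ.im ^ a) =
      ∫⁻ ρ in {ρ : ℍ | 0 ≤ ρ.re ∧ ρ.re < 1}, F ρ := by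
    refine lintegral_congr fun ρ ↦ ?_
    rw [hFdef]
    dsimp only
    rw [ofComplex_apply, UpperHalfPlane.coe_im]
  rw [e0, lintegral_strip_eq_lintegral_Ioi_Ico F hF]
  -- the inner integral, for `y > 0`
  have hinner : ∀ y ∈ Ioi (0 : ℝ), ∫⁻ x in Ico (0 : ℝ) 1, F ⟨x, y⟩ * ENNReal.ofReal (1 / y ^ 2) =
      ∑' n : ℕ, ENNReal.ofReal (‖cuspCoeff f n‖ ^ 2 * Real.exp (-(4 * π * n * y)) * y ^ (a - 2)) := by
    intro y hy
    rw [mem_Ioi] at hy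
    have e1 : ∀ x : ℝ, F ⟨x, y⟩ = ENNReal.ofReal (‖f ⟨x + y * Complex.I, by simp [hy]⟩‖ ^ 2) *
        ENNReal.ofReal (y ^ a) := by
      intro x
      rw [hFdef]
      dsimp only
      rw [ofComplex_apply_of_im_pos (show 0 < (⟨x, y⟩ : ℂ).im from hy), ← ENNReal.ofReal_mul (sq_nonneg _)]
      have hpt : (⟨⟨x, y⟩, (show 0 < (⟨x, y⟩ : ℂ).im from hy)⟩ : ℍ) = ⟨x + y * Complex.I, by simp [hy]⟩ :=
        UpperHalfPlane.ext (Complex.mk_eq_add_mul_I x y)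
      rw [hpt]
    simp_rw [e1]
    have hm : Measurable fun x : ℝ ↦ ENNReal.ofReal (‖f ⟨x + y * Complex.I, by simp [hy]⟩‖ ^ 2) := by
      refine ((Continuous.norm ?_).pow 2).measurable.ennreal_ofReal
      apply (ModularFormClass.continuous f).comp
      fun_prop (disch := simp [hy])
    rw [lintegral_mul_const _ (hm.mul_const _), lintegral_mul_const _ hm,
      lintegral_Ico_normSq_line_eq_tsum hΓ f hy, ← ENNReal.tsum_mul_right, ← ENNReal.tsum_mul_right]
    refine tsum_congr fun n ↦ ?_
    rw [← ENNReal.ofReal_mul (by positivity), ← ENNReal.ofReal_mul (by positivity)]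
    congr 1
    rw [show y ^ (a - 2) = y ^ a / y ^ 2 by
      rw [Real.rpow_sub hy, Real.rpow_two]]
    field_simp
  rw [setLIntegral_congr_fun measurableSet_Ioi hinner]
  -- swap the sum and the `y`-integral, and evaluate the `Γ`-integrals
  have hmn : ∀ n : ℕ, Measurable fun y : ℝ ↦
      ENNReal.ofReal (‖cuspCoeff f n‖ ^ 2 * Real.exp (-(4 * π * n * y)) * y ^ (a - 2)) := by
    intro n
    refine Measurable.ennreal_ofReal ?_
    refine Measurable.mul (Measurable.mul measurable_const ?_) (measurable_id.pow_const _)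
    exact Real.measurable_exp.comp (by fun_prop)
  rw [lintegral_tsum fun n ↦ (hmn n).aemeasurable]
  refine tsum_congr fun n ↦ ?_
  rcases Nat.eq_zero_or_pos n with rfl | hn
  · simp [cuspCoeff_zero hΓ f]
  · have hr : 0 < 4 * π * (n : ℝ) := by positivity
    have ha1 : 0 < a - 1 := by linarith
    calc ∫⁻ y in Ioi (0 : ℝ), ENNReal.ofReal (‖cuspCoeff f n‖ ^ 2 * Real.exp (-(4 * π * n * y)) * y ^ (a - 2))
        = ∫⁻ y in Ioi (0 : ℝ), ENNReal.ofReal (‖cuspCoeff f n‖ ^ 2) *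
            ENNReal.ofReal (y ^ (a - 1 - 1) * Real.exp (-(4 * π * n * y))) := by
          refine setLIntegral_congr_fun measurableSet_Ioi fun y hy ↦ ?_
          rw [← ENNReal.ofReal_mul (sq_nonneg _)]
          congr 1
          rw [show a - 1 - 1 = a - 2 by ring]
          ring
      _ = ENNReal.ofReal (‖cuspCoeff f n‖ ^ 2) *
            ∫⁻ y in Ioi (0 : ℝ), ENNReal.ofReal (y ^ (a - 1 - 1) * Real.exp (-(4 * π * n * y))) :=
          lintegral_const_mul _ (Measurable.ennreal_ofReal ((measurable_id.pow_const _).mul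
            (Real.measurable_exp.comp (by fun_prop))))
      _ = ENNReal.ofReal (‖cuspCoeff f n‖ ^ 2) *
            ENNReal.ofReal ((1 / (4 * π * n)) ^ (a - 1) * Real.Gamma (a - 1)) := by
          rw [lintegral_Ioi_rpow_mul_exp_neg_mul ha1 hr]
      _ = ENNReal.ofReal (‖cuspCoeff f n‖ ^ 2 * ((1 / (4 * π * n)) ^ (a - 1) * Real.Gamma (a - 1))) :=
          (ENNReal.ofReal_mul (sq_nonneg _)).symm

end StripCuspForm

end Literature.NumberTheory.EllipticCurves.ModularForms

end
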